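/-
Copyright: pub-balaban β-flow team, β-FLOW PROVER 4 (unit `b2b-balaban-beta-bflow-p4`, gen 16; coordinator ruling «YM
ACCELERATION» 2026-08-21 item (2), «work behind the as-printed interface»).  THE EUCLIDEAN ACTIONS ON PERIODIC BOND FIELDS AND
THEIR CURLS: periodicity of curl B, of the reflected field (εB)_ν(y) = ε_ν B_ν(εy − [ν=α]e_α) and of the permuted field
(πB)_c(y) = B_{σ⁻¹c}(y∘σ); PART 25c's plaquette law for the reflected curl with the base point REDUCED into the period box; the
plaquette law for the permuted curl (ordered and sorted labels, with the orientation sign); the sorted-label bookkeeping of an axis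
permutation.  Lattice bookkeeping; nothing of Bałaban's asserted; NOT N5 for the model, NOT BetaPertH, NOT continuum, NOT Clay.
-/
import Mathlib
import Summits.QuantumFields.BalabanUV.Beta.EriceCurvatureFormReflection
import Summits.QuantumFields.BalabanUV.Beta.EriceCurvatureFormTorusCovariance

/-!
# `Beta.EriceCurvatureFormTorusCurl` — PART 29b of the `EriceLoopExpansionD4` series: reflections and axis permutations acting on
# periodic bond fields; the transformation laws of the curl on the torus

Source: T. Bałaban, Commun. Math. Phys. **109** (1987) [Balaban1987RG1] (5.2)–(5.3) p. 292 (Euclidean transformations r of the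
torus act on fields by (rB)(b) = B(r⁻¹b), on bonds with orientation), (5.6)–(5.8) pp. 292–293; T. Bałaban, A. Jaffe, *Constructive
gauge theory* (Erice 1985) [BalabanJaffe1986], Part III (3.38)–(3.40) p. 245 (the torus T_{L^{−j}}), (3.65)–(3.67) p. 249; this
lineage's PART 25c `EriceCurvatureFormReflection.curl_reflect` ((5.3) on plaquettes: (εF)(x,(a,b)) = ε_aε_b·F(εx − [α∈{a,b}]e_α,(a,b))),
PART 28b `EriceCurvatureFormTorusCovariance` (period box □_N, `apply_emod_eq_of_periodic`, `emod_mem_box`).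

LETTERS.  B : ℤ^d → (Fin d → ℝ) a bond field, N-PERIODIC (`hB : B(y + N•v) = B(y)`) — a field on the torus read on ℤ^d; its curl
F(x,(a,b)) = B_a(x) + B_b(x+e_a) − B_a(x+e_b) − B_b(x) (`hF`, ALL ordered pairs (a,b)); the reflected field of axis α,
(εB)_ν(y) = ε_ν·B_ν(εy − [ν=α]e_α) (`hBε`, PART 25c's letter); the permuted field of an axis permutation σ, (πB)_c(y) = B_{σ⁻¹c}(y∘σ)
(`hBπ`: the coordinate map x ↦ x∘σ⁻¹ sends the bond (x,c) to (x∘σ⁻¹, σc), and (πB)(x∘σ⁻¹, σc) = B(x,c)).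

WHAT IS KERNEL-CHECKED HERE (def-free; [folklore] lattice bookkeeping):
* §1 `axisReflect_zsmul`, `curl_periodic`, `reflect_periodic`, `comp_perm_add`, `comp_perm_zsmul`, `perm_periodic` (the actions
  preserve N-periodicity), `apply_emod_periodic₂` (a periodic plaquette function at the reduced base point).
* §2 **`curl_reflect_emod`** — PART 25c's law with the base point reduced into □_N: (εF)(x,o) = ε_{o.1}ε_{o.2}·F((εx − [α∈o]e_α) mod N, o)
  for periodic B.
* §3 `comp_perm_add_e` ((y + e_c)∘σ = y∘σ + e_{σ⁻¹c}), **`curl_perm`** ((πF)(y,(c,c′)) = F(y∘σ,(σ⁻¹c,σ⁻¹c′)), ordered pairs),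
  `curl_swap` (F(x,(b,a)) = −F(x,(a,b))), **`curl_perm_sorted`** (sorted label ℓ′: (πF)(y,ℓ′) = sgn·F(y∘σ, sort(σ⁻¹ℓ′)) with
  sgn = [σ⁻¹ℓ′ ordered] − [not], sort = (min, max)).
* §4 sorted-label bookkeeping of σ: `min_lt_max_perm`, `sort_perm_sort_symm` (sort(σ(sort(σ⁻¹ℓ′))) = ℓ′ for sorted ℓ′),
  `sort_perm_injective`, `sign_perm_sort_symm` (the sign read on the pulled-back label).
HONEST: exact identities for ANY periodic bond field; nothing of Bałaban's asserted; NOT N5 for the model, NOT (3.36), NOT B12 Thm 2,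
NOT BetaPertH, NOT continuum, NOT Clay.  HONEST DEPENDENCY: continuum YM on T⁴ ⇐ BetaPertH ∧ nine spine estimates (0/9 proved);
BetaPertH ⇐ (D1) ∧ (D4) ∧ CAP+tail; G-an2-4 gates asym, D1 and NE2/3/4.
-/

namespace Summit.QuantumFields.BalabanUV.Beta.EriceCurvatureFormTorusCurl

open scoped BigOperators
open Finset
open Literature.MathematicalPhysics.QuantumFieldTheory.Balaban1983to89
open Literature.MathematicalPhysics.QuantumFieldTheory.Balaban1983to89.B7Prop1Explicit (e e_apply)
open Literature.MathematicalPhysics.QuantumFieldTheory.Balaban1983to89.Beta.PolarizationSign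
  (axisReflect axisReflect_apply reflSign)
open Summit.QuantumFields.BalabanUV.Beta.EriceCurvatureFormReflection (axisReflect_add axisReflect_sub curl_reflect reflSign_mul_self)
open Summit.QuantumFields.BalabanUV.Beta.EriceCurvatureFormTorusCovariance (apply_emod_eq_of_periodic emod_mem_box)

variable {d : ℕ}

/-! ## §1. The actions preserve periodicity -/

/-- ε(N•v) = N•(εv). [folklore] -/
theorem axisReflect_zsmul (α : Fin d) (N : ℤ) (v : Fin d → ℤ) : axisReflect α (N • v) = N • axisReflect α v := by
  funext i; by_cases h : i = α <;> simp [h]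

/-- **The curl of a periodic bond field is periodic.** [folklore] -/
theorem curl_periodic {N : ℤ} (B : (Fin d → ℤ) → Fin d → ℝ) (hB : ∀ (y v : Fin d → ℤ) (ν : Fin d), B (y + N • v) ν = B y ν)
    (F : (Fin d → ℤ) → Fin d × Fin d → ℝ)
    (hF : ∀ x o, F x o = B x o.1 + B (x + e o.1) o.2 - B (x + e o.2) o.1 - B x o.2) (x v : Fin d → ℤ)
    (o : Fin d × Fin d) : F (x + N • v) o = F x o := by
  rw [hF, hF, add_right_comm x (N • v) (e o.1), add_right_comm x (N • v) (e o.2), hB, hB, hB, hB]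

/-- **The reflected field of a periodic bond field is periodic** ((εB)_ν(y) = ε_ν·B_ν(εy − [ν=α]e_α), PART 25c's letter `hBε`).
[cite: Balaban1987RG1, (5.3) p.292] -/
theorem reflect_periodic {N : ℤ} (α : Fin d) (B Bε : (Fin d → ℤ) → Fin d → ℝ)
    (hBε : ∀ y ν, Bε y ν = reflSign α ν * B (axisReflect α y - if ν = α then e α else 0) ν)
    (hB : ∀ (y v : Fin d → ℤ) (ν : Fin d), B (y + N • v) ν = B y ν) (y v : Fin d → ℤ) (ν : Fin d) :
    Bε (y + N • v) ν = Bε y ν := by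
  rw [hBε, hBε, axisReflect_add, axisReflect_zsmul]
  have : axisReflect α y + N • axisReflect α v - (if ν = α then e α else 0)
      = (axisReflect α y - if ν = α then e α else 0) + N • axisReflect α v := by abel
  rw [this, hB]

/-- (y + w)∘σ = y∘σ + w∘σ. [folklore] -/
theorem comp_perm_add (σ : Equiv.Perm (Fin d)) (y w : Fin d → ℤ) : (y + w) ∘ σ = y ∘ σ + w ∘ σ := by
  funext i; simp

/-- (N•v)∘σ = N•(v∘σ). [folklore] -/
theorem comp_perm_zsmul (σ : Equiv.Perm (Fin d)) (N : ℤ) (v : Fin d → ℤ) : (N • v) ∘ σ = N • (v ∘ σ) := by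
  funext i; simp

/-- **The permuted field of a periodic bond field is periodic** ((πB)_c(y) = B_{σ⁻¹c}(y∘σ), letter `hBπ`).
[cite: Balaban1987RG1, (5.2)-(5.3) p.292] -/
theorem perm_periodic {N : ℤ} (σ : Equiv.Perm (Fin d)) (B Bπ : (Fin d → ℤ) → Fin d → ℝ)
    (hBπ : ∀ y c, Bπ y c = B (y ∘ σ) (σ.symm c))
    (hB : ∀ (y v : Fin d → ℤ) (ν : Fin d), B (y + N • v) ν = B y ν) (y v : Fin d → ℤ) (c : Fin d) :
    Bπ (y + N • v) c = Bπ y c := by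
  rw [hBπ, hBπ, comp_perm_add, comp_perm_zsmul, hB]

/-- A periodic plaquette function at the reduced base point: F(y mod N, o) = F(y, o). [folklore] -/
theorem apply_emod_periodic₂ {N : ℤ} (F : (Fin d → ℤ) → Fin d × Fin d → ℝ)
    (hFper : ∀ (x v : Fin d → ℤ) (o : Fin d × Fin d), F (x + N • v) o = F x o) (y : Fin d → ℤ) (o : Fin d × Fin d) :
    F (fun i => y i % N) o = F y o :=
  apply_emod_eq_of_periodic (fun z => F z o) (fun w v => hFper w v o) y

/-! ## §2. The reflected curl with the base point reduced into the period box -/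

/-- **(5.3) ON PLAQUETTES, TORUS FORM.**  For an N-periodic bond field B with curl F (`hF`), reflected field εB (`hBε`) with curl Fε
(`hFε`): (εF)(x,o) = ε_{o.1}ε_{o.2}·F((εx − [α ∈ o]e_α) mod N, o) — PART 25c's `curl_reflect` with the pulled-back base point READ IN
THE BOX □_N (the curl of a periodic field is periodic).  The pulled-back plaquette ((εx − [α∈o]e_α) mod N, o) is the one a
consumer with site sets inside □_N needs. [cite: Balaban1987RG1, (5.3) p.292, (5.7) p.293] -/
theorem curl_reflect_emod {N : ℤ} (α : Fin d) (B Bε : (Fin d → ℤ) → Fin d → ℝ)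
    (hBε : ∀ y ν, Bε y ν = reflSign α ν * B (axisReflect α y - if ν = α then e α else 0) ν)
    (hB : ∀ (y v : Fin d → ℤ) (ν : Fin d), B (y + N • v) ν = B y ν)
    (F Fε : (Fin d → ℤ) → Fin d × Fin d → ℝ)
    (hF : ∀ x o, F x o = B x o.1 + B (x + e o.1) o.2 - B (x + e o.2) o.1 - B x o.2)
    (hFε : ∀ x o, Fε x o = Bε x o.1 + Bε (x + e o.1) o.2 - Bε (x + e o.2) o.1 - Bε x o.2) (x : Fin d → ℤ)
    (o : Fin d × Fin d) :
    Fε x o = (reflSign α o.1 * reflSign α o.2)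
      * F (fun i => (axisReflect α x - if (α = o.1 ∨ α = o.2) then e α else 0) i % N) o := by
  rw [apply_emod_periodic₂ F (curl_periodic B hB F hF), curl_reflect α B Bε hBε F Fε hF hFε x o]

/-! ## §3. The permuted curl -/

/-- (y + e_c)∘σ = y∘σ + e_{σ⁻¹c}: the coordinate map pulls the unit vector e_c back to e_{σ⁻¹c}. [folklore] -/
theorem comp_perm_add_e (σ : Equiv.Perm (Fin d)) (y : Fin d → ℤ) (c : Fin d) : (y + e c) ∘ σ = y ∘ σ + e (σ.symm c) := by
  funext i
  simp only [Function.comp_apply, Pi.add_apply, e_apply]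
  congr 1
  by_cases h : σ i = c
  · rw [if_pos h, if_pos ((Equiv.apply_eq_iff_eq_symm_apply σ).1 h)]
  · rw [if_neg h, if_neg (fun h' => h ((Equiv.apply_eq_iff_eq_symm_apply σ).2 h'))]

/-- **THE PERMUTED CURL (ordered pairs).**  For the permuted field (πB)_c(y) = B_{σ⁻¹c}(y∘σ) (`hBπ`) with curl Fπ (`hFπ`, the curl
formula at all ordered pairs): (πF)(y,(c,c′)) = F(y∘σ,(σ⁻¹c,σ⁻¹c′)) — the plaquette (x,(a,b)) is carried to (x∘σ⁻¹,(σa,σb)) with its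
orientation. [cite: Balaban1987RG1, (5.2)-(5.3) p.292, (5.6) p.292] -/
theorem curl_perm (σ : Equiv.Perm (Fin d)) (B Bπ : (Fin d → ℤ) → Fin d → ℝ) (hBπ : ∀ y c, Bπ y c = B (y ∘ σ) (σ.symm c))
    (F Fπ : (Fin d → ℤ) → Fin d × Fin d → ℝ)
    (hF : ∀ x o, F x o = B x o.1 + B (x + e o.1) o.2 - B (x + e o.2) o.1 - B x o.2)
    (hFπ : ∀ x o, Fπ x o = Bπ x o.1 + Bπ (x + e o.1) o.2 - Bπ (x + e o.2) o.1 - Bπ x o.2) (y : Fin d → ℤ) (c c' : Fin d) :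
    Fπ y (c, c') = F (y ∘ σ) (σ.symm c, σ.symm c') := by
  rw [hFπ, hF, hBπ, hBπ, hBπ, hBπ, comp_perm_add_e, comp_perm_add_e]

/-- The curl formula is odd under exchange of the two directions: F(x,(b,a)) = −F(x,(a,b)). [folklore] -/
theorem curl_swap (B : (Fin d → ℤ) → Fin d → ℝ) (F : (Fin d → ℤ) → Fin d × Fin d → ℝ)
    (hF : ∀ x o, F x o = B x o.1 + B (x + e o.1) o.2 - B (x + e o.2) o.1 - B x o.2) (x : Fin d → ℤ) (a b : Fin d) :
    F x (b, a) = -F x (a, b) := by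
  rw [hF, hF]; ring

/-- **THE PERMUTED CURL AT A SORTED LABEL.**  For ℓ′ = (c,c′) with c < c′: (πF)(y,ℓ′) = sgn·F(y∘σ, sort(σ⁻¹ℓ′)) where sort = (min, max)
and sgn = +1 if σ⁻¹c < σ⁻¹c′ (orientation kept), −1 otherwise (orientation reversed). [cite: Balaban1987RG1, (5.2)-(5.3) p.292] -/
theorem curl_perm_sorted (σ : Equiv.Perm (Fin d)) (B Bπ : (Fin d → ℤ) → Fin d → ℝ)
    (hBπ : ∀ y c, Bπ y c = B (y ∘ σ) (σ.symm c))
    (F Fπ : (Fin d → ℤ) → Fin d × Fin d → ℝ)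
    (hF : ∀ x o, F x o = B x o.1 + B (x + e o.1) o.2 - B (x + e o.2) o.1 - B x o.2)
    (hFπ : ∀ x o, Fπ x o = Bπ x o.1 + Bπ (x + e o.1) o.2 - Bπ (x + e o.2) o.1 - Bπ x o.2) (y : Fin d → ℤ)
    (ℓ' : Fin d × Fin d) :
    Fπ y ℓ' = (if σ.symm ℓ'.1 < σ.symm ℓ'.2 then 1 else -1)
      * F (y ∘ σ) (min (σ.symm ℓ'.1) (σ.symm ℓ'.2), max (σ.symm ℓ'.1) (σ.symm ℓ'.2)) := by
  obtain ⟨c, c'⟩ := ℓ'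
  simp only
  rw [curl_perm σ B Bπ hBπ F Fπ hF hFπ y c c']
  by_cases h : σ.symm c < σ.symm c'
  · rw [if_pos h, min_eq_left h.le, max_eq_right h.le, one_mul]
  · rw [if_neg h, min_eq_right (not_lt.1 h), max_eq_left (not_lt.1 h), curl_swap B F hF]
    ring

/-! ## §4. Sorted-label bookkeeping of an axis permutation -/

/-- For a sorted pair (a,b) and a permutation σ: min(σa,σb) < max(σa,σb). [folklore] -/
theorem min_lt_max_perm (σ : Equiv.Perm (Fin d)) {a b : Fin d} (h : a < b) : min (σ a) (σ b) < max (σ a) (σ b) :=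
  min_lt_max.2 (fun heq => (ne_of_lt h) (σ.injective heq))

/-- sort(σ(sort(σ⁻¹ℓ′))) = ℓ′ for a sorted ℓ′: the sorted image under σ of the sorted pull-back is the original label. [folklore] -/
theorem sort_perm_sort_symm (σ : Equiv.Perm (Fin d)) {c c' : Fin d} (h : c < c') :
    (min (σ (min (σ.symm c) (σ.symm c'))) (σ (max (σ.symm c) (σ.symm c'))),
      max (σ (min (σ.symm c) (σ.symm c'))) (σ (max (σ.symm c) (σ.symm c')))) = (c, c') := by
  by_cases hlt : σ.symm c ≤ σ.symm c'
  · rw [min_eq_left hlt, max_eq_right hlt, Equiv.apply_symm_apply, Equiv.apply_symm_apply, min_eq_left h.le,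
      max_eq_right h.le]
  · rw [min_eq_right (not_le.1 hlt).le, max_eq_left (not_le.1 hlt).le, Equiv.apply_symm_apply, Equiv.apply_symm_apply,
      min_eq_right h.le, max_eq_left h.le]

/-- The sorted image ℓ ↦ sort(σℓ) is injective on sorted pairs. [folklore] -/
theorem sort_perm_injective (σ : Equiv.Perm (Fin d)) {a b a' b' : Fin d} (h : a < b) (h' : a' < b')
    (heq : (min (σ a) (σ b), max (σ a) (σ b)) = (min (σ a') (σ b'), max (σ a') (σ b'))) : (a, b) = (a', b') := by
  have h1 : min (σ a) (σ b) = min (σ a') (σ b') := congrArg Prod.fst heq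
  have h2 : max (σ a) (σ b) = max (σ a') (σ b') := congrArg Prod.snd heq
  -- the unordered pairs {σa,σb} and {σa′,σb′} coincide, hence {a,b} = {a′,b′}; the orders decide
  have hab : ({σ a, σ b} : Finset (Fin d)) = {σ a', σ b'} := by
    rw [← Finset.insert_eq_of_mem (Finset.mem_insert_self (σ a) {σ b}),
      ← Finset.insert_eq_of_mem (Finset.mem_insert_self (σ a') {σ b'})]
    have e1 : ({σ a, σ b} : Finset (Fin d)) = {min (σ a) (σ b), max (σ a) (σ b)} := by
      rcases le_total (σ a) (σ b) with hh | hh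
      · rw [min_eq_left hh, max_eq_right hh]
      · rw [min_eq_right hh, max_eq_left hh, Finset.pair_comm]
    have e2 : ({σ a', σ b'} : Finset (Fin d)) = {min (σ a') (σ b'), max (σ a') (σ b')} := by
      rcases le_total (σ a') (σ b') with hh | hh
      · rw [min_eq_left hh, max_eq_right hh]
      · rw [min_eq_right hh, max_eq_left hh, Finset.pair_comm]
    rw [Finset.insert_eq_of_mem (Finset.mem_insert_self _ _), Finset.insert_eq_of_mem (Finset.mem_insert_self _ _), e1, e2,
      h1, h2]
  have hab' : ({a, b} : Finset (Fin d)) = {a', b'} := by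
    have := congrArg (Finset.image σ.symm) hab
    simpa [Finset.image_insert, Finset.image_singleton] using this
  have ha : a ∈ ({a', b'} : Finset (Fin d)) := hab' ▸ Finset.mem_insert_self a {b}
  have hb : b ∈ ({a', b'} : Finset (Fin d)) := hab' ▸ Finset.mem_insert_of_mem (Finset.mem_singleton_self b)
  simp only [Finset.mem_insert, Finset.mem_singleton] at ha hb
  rcases ha with ha | ha <;> rcases hb with hb | hb
  · exact absurd (ha.trans hb.symm) (ne_of_lt h)
  · rw [ha, hb]
  · rw [ha, hb] at h; exact absurd (h.trans h') (lt_irrefl _)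
  · exact absurd (ha.trans hb.symm) (ne_of_lt h)

/-- The orientation sign of σ read on the pulled-back sorted label: for sorted ℓ′ = (c,c′) and ℓ := sort(σ⁻¹ℓ′),
[σ⁻¹c < σ⁻¹c′] − [not] = [σℓ.1 < σℓ.2] − [not]. [folklore] -/
theorem sign_perm_sort_symm (σ : Equiv.Perm (Fin d)) {c c' : Fin d} (h : c < c') :
    (if σ.symm c < σ.symm c' then (1 : ℝ) else -1)
      = if σ (min (σ.symm c) (σ.symm c')) < σ (max (σ.symm c) (σ.symm c')) then 1 else -1 := by
  by_cases hlt : σ.symm c < σ.symm c'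
  · rw [if_pos hlt, min_eq_left hlt.le, max_eq_right hlt.le, Equiv.apply_symm_apply, Equiv.apply_symm_apply, if_pos h]
  · rw [if_neg hlt, min_eq_right (not_lt.1 hlt), max_eq_left (not_lt.1 hlt), Equiv.apply_symm_apply,
      Equiv.apply_symm_apply, if_neg (not_lt.2 h.le)]

end Summit.QuantumFields.BalabanUV.Beta.EriceCurvatureFormTorusCurl
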